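import Literature.Geometry.Riemannian.RicciDeTurckChartFamily
import Literature.Geometry.Riemannian.RicciDeTurckDataLipschitz
import Literature.Geometry.Riemannian.MaximumPrincipleAtMaxima
import Literature.Topology.FourManifolds.MorseExtrema
import HarnessLib

/-!
# The square norm of the difference of two Ricci–DeTurck flows read in a chart
(topic `Geometry/Riemannian`)

Tenth layer of the DeTurck decomposition of the named fact
`Literature.Geometry.Riemannian.ricciFlow_uniqueness` (`RicciFlow.lean`; Hamilton 1982,
Thm. 5.1; Topping 2006, Thm. 5.2.2), towards uniqueness of the Ricci–DeTurck flow on a closed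
manifold (hypothesis (RU) of `RicciDeTurckReduction.lean`; Andrews–Hopper 2011, §5.4.2,
Step 1: "standard theory" of strictly parabolic systems) by the maximum principle applied to
`u = |g₁ - g₂|²_h`. This file sets up the function `u` IN THE COORDINATES OF A CHART: its
explicit formula `û_t(y) = ⟨G¹_t(y) - G²_t(y), G¹_t(y) - G²_t(y)⟩_{h(y)}` in terms of the
representatives `Gⁱ_t = chartRep I kᵢ z t` (`RicciDeTurckChartFamily.lean`), its time
derivative along two Ricci–DeTurck flows (from the coordinate Ricci–DeTurck equation
`IsRicciDeTurckFlow.hasDerivWithinAt_chartRep`), its joint continuity, the regularity of the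
coefficient data, the sign `gᵖ𐞥 ∂ₚ∂_q û ≤ 0` at a spatial maximum, and the uniform ellipticity
of the inverse metric `g₁ᵖ𐞥` on compact sets. Everything is proved; no named fact and no
`sorry` is introduced.

## Contents (all proved)

* Generic tools: `continuousWithinAt_matrix_inv_apply` (entries of the inverse of a continuous
  family of invertible matrices are continuous), `exists_nonneg_forall_norm_le` (bounds on
  compact sets), `wsumBound_le_of_forall_abs_le`, `normSqCoord_congr_left`, `contDiffAt_wsum`,
  **`gramInv_quadratic_pos`** (the inverse Gram matrix of a positive definite form is positive
  definite: `ξᵀ G⁻¹ ξ = ηᵀ G η`, `η = G⁻¹ξ`), **`exists_ellipticity_const`** (a continuous family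
  of positive definite quadratic forms on a compact set is uniformly elliptic).
* Chart data: `bgChris` (background Christoffel representative `Γ̃`), `chartLower` (the
  lower-order part `F(G, ∂G)`), `chartRHS` (the right-hand side `gᵖ𐞥∂ₚ∂_qG + F(G, ∂G)` of the
  coordinate Ricci–DeTurck equation),
  **`chartNormSq`** (`û`), `chartDot` (`∂ₜ(G¹ - G²)` as a form with the prescribed components);
  `IsRicciDeTurckFlow.hasDerivWithinAt_chartRep_chartRHS`;
  **`hasDerivWithinAt_chartNormSq`** (`∂ₜû = 2⟨∂ₜH, H⟩_h`);
  **`normSq_sub_eq_chartNormSq`** (`|k₁ - k₂|²_h (Φ y) = û(y)`: naturality of the square norm,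
  `normSq_chartPullback_eq`); `continuousOn_chartNormSq` (joint continuity on `target × S`);
  `contDiffOn_chartRep_slice`, `contDiffOn_gramInv_chartRep_const`,
  `continuousOn_gramInv_chartRep`, `contDiffOn_bgChris` (regularity of the data);
  **`sum_gramInv_fderiv_fderiv_nonpos`** (`g₁ᵖ𐞥 ∂ₚ∂_q F(y₀) = tr_{g₁} D²F(y₀) ≤ 0` at a local
  maximum `y₀` of a `C²` function `F`: the tree's
  `IsLocalMax.fderiv_fderiv_apply_self_nonpos` and `trace_nonpos_of_forall_apply_self_nonpos`);
  `gramInv_chartRep_quadratic_pos`.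

## References

* B. Andrews, C. Hopper, *The Ricci flow in Riemannian geometry*, LNM 2011 (2011), §5.4.1–§5.4.2,
  (5.10), Step 1. [AndrewsHopper2011]
* P. Topping, *Lectures on the Ricci flow*, LMS LNS 325 (2006), §3.1 (proof of Thm. 3.1.1), §5.2.
  [Topping2006]
* B. O'Neill, *Semi-Riemannian geometry*, Academic Press 1983, Ch. 3, pp. 60–61, Prop. 3.59.
  [ONeill1983]
-/

noncomputable section

set_option maxSynthPendingDepth 3

open Bundle Set Function Filter FiberBundle VectorField ContinuousLinearMap TopologicalSpace
open scoped Manifold ContDiff Topology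

namespace Literature.Geometry.Riemannian

open Lorentzian Lorentzian.OpensChart Lorentzian.PseudoRiemannianMetric
open Literature.Geometry.Riemannian.OpensChart

/-! ### Generic tools -/

section Generic

variable {X : Type*} [TopologicalSpace X] {ι : Type*} [Fintype ι] [DecidableEq ι]

/-- **The entries of the inverse of a continuous family of matrices are continuous where the
determinant does not vanish** (`A⁻¹ = (det A)⁻¹ • adj A`, Mathlib's `continuousAt_matrix_inv`
and `NormedRing.inverse_continuousAt`). [folklore] -/
theorem continuousWithinAt_matrix_inv_apply {A : X → Matrix ι ι ℝ} {s : Set X} {x₀ : X}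
    (hA : ∀ i j, ContinuousWithinAt (fun x ↦ A x i j) s x₀) (h0 : (A x₀).det ≠ 0) (i j : ι) :
    ContinuousWithinAt (fun x ↦ (A x)⁻¹ i j) s x₀ := by
  have hAc : ContinuousWithinAt A s x₀ :=
    continuousWithinAt_pi.2 fun i ↦ continuousWithinAt_pi.2 fun j ↦ hA i j
  have hunit : ContinuousAt Ring.inverse (A x₀).det := by
    have h := NormedRing.inverse_continuousAt (Units.mk0 _ h0)
    rwa [Units.val_mk0] at h
  have hinv : ContinuousAt (Inv.inv : Matrix ι ι ℝ → Matrix ι ι ℝ) (A x₀) :=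
    continuousAt_matrix_inv (A x₀) hunit
  have h := hinv.comp_continuousWithinAt hAc
  exact continuousWithinAt_pi.1 (continuousWithinAt_pi.1 h i) j

/-- A continuous function on a compact set is bounded by a nonnegative constant. [folklore] -/
theorem exists_nonneg_forall_norm_le {Y : Type*} [SeminormedAddCommGroup Y]
    {K : Set X} (hK : IsCompact K) {f : X → Y} (hf : ContinuousOn f K) :
    ∃ C : ℝ, 0 ≤ C ∧ ∀ x ∈ K, ‖f x‖ ≤ C := by
  obtain ⟨C, hC⟩ := hK.exists_bound_of_continuousOn hf
  exact ⟨max C 0, le_max_right _ _, fun x hx ↦ (hC x hx).trans (le_max_left _ _)⟩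

variable {E : Type*} [NormedAddCommGroup E] [NormedSpace ℝ E] (b : Module.Basis ι ℝ E)

omit [DecidableEq ι] in
/-- `wsumBound` of an array with entries bounded by `C` is at most `C` times the basis
constant `∑ ‖b_c‖ ‖bᵢ‖ ‖bₐ‖ ‖bⱼ‖`. [folklore] -/
theorem wsumBound_le_of_forall_abs_le {wt : ι → ι → ι → ι → ℝ} {C : ℝ}
    (hwt : ∀ i j a c, |wt i j a c| ≤ C) :
    wsumBound b wt ≤ C * ∑ i, ∑ j, ∑ a, ∑ c, ‖b c‖ * ‖b i‖ * ‖b a‖ * ‖b j‖ := by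
  unfold wsumBound
  rw [Finset.mul_sum]
  refine Finset.sum_le_sum fun i _ ↦ ?_
  rw [Finset.mul_sum]
  refine Finset.sum_le_sum fun j _ ↦ ?_
  rw [Finset.mul_sum]
  refine Finset.sum_le_sum fun a _ ↦ ?_
  rw [Finset.mul_sum]
  refine Finset.sum_le_sum fun c _ ↦ ?_
  have h := hwt i j a c
  have h0 : 0 ≤ ‖b c‖ * ‖b i‖ * ‖b a‖ * ‖b j‖ := by positivity
  calc |wt i j a c| * ‖b c‖ * ‖b i‖ * ‖b a‖ * ‖b j‖
      = |wt i j a c| * (‖b c‖ * ‖b i‖ * ‖b a‖ * ‖b j‖) := by ring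
    _ ≤ C * (‖b c‖ * ‖b i‖ * ‖b a‖ * ‖b j‖) := mul_le_mul_of_nonneg_right h h0

omit [DecidableEq ι] in
/-- `normSqCoordBound` is `wsumBound` of the weights `gʲⁱ gᶜᵃ`. [folklore] -/
theorem normSqCoordBound_eq_wsumBound (Gi : Matrix ι ι ℝ) :
    normSqCoordBound b Gi = wsumBound b (fun i j a c ↦ Gi j i * Gi c a) := by
  simp only [normSqCoordBound, wsumBound, abs_mul]

omit [DecidableEq ι] in
/-- `normSqCoord b Gi X T` depends on `X` only through its components `X(b_c, bᵢ)`. [folklore] -/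
theorem normSqCoord_congr_left (Gi : Matrix ι ι ℝ) {X X' : E →L[ℝ] E →L[ℝ] ℝ}
    (hX : ∀ c i, X (b c) (b i) = X' (b c) (b i)) (T : E →L[ℝ] E →L[ℝ] ℝ) :
    normSqCoord b Gi X T = normSqCoord b Gi X' T := by
  simp only [normSqCoord, hX]

omit [DecidableEq ι] in
/-- `y ↦ wsum (wf y) (H y) (H y)` is `C^n` at a point where the weights and the forms are.
[folklore] -/
theorem contDiffAt_wsum {wf : E → ι → ι → ι → ι → ℝ} {Hf : E → E →L[ℝ] E →L[ℝ] ℝ} {x : E}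
    {n : WithTop ℕ∞} (hw : ∀ i j a c, ContDiffAt ℝ n (fun y ↦ wf y i j a c) x)
    (hH : ContDiffAt ℝ n Hf x) :
    ContDiffAt ℝ n (fun y ↦ wsum b (wf y) (Hf y) (Hf y)) x := by
  unfold wsum
  refine ContDiffAt.sum fun i _ ↦ ContDiffAt.sum fun j _ ↦ ContDiffAt.sum fun a _ ↦
    ContDiffAt.sum fun c _ ↦ ?_
  exact ((hw i j a c).mul (contDiffAt_apply₂ hH _ _)).mul (contDiffAt_apply₂ hH _ _)

/-- **The inverse Gram matrix of a positive definite symmetric form is positive definite**: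
for `ξ ≠ 0`, `∑_{p,q} (G⁻¹)_{qp} ξ_p ξ_q > 0`. Proof: with `η = G⁻¹ ξ` one has `G η = ξ`, so the
quadratic form equals `ηᵀ G η = A(v, v)` for `v = ∑ ηᵢ bᵢ ≠ 0`. [folklore] -/
theorem gramInv_quadratic_pos {A : E →L[ℝ] E →L[ℝ] ℝ}
    (hpos : ∀ v, v ≠ 0 → 0 < A v v) (hdet : (Matrix.of fun i j ↦ A (b i) (b j)).det ≠ 0)
    {ξ : ι → ℝ} (hξ : ξ ≠ 0) : 0 < ∑ p, ∑ q, gramInv b A q p * ξ p * ξ q := by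
  set η : ι → ℝ := (gramInv b A).mulVec ξ with hη
  have hMη : (Matrix.of fun i j ↦ A (b i) (b j)).mulVec η = ξ := by
    rw [hη, Matrix.mulVec_mulVec, gramInv, Matrix.mul_nonsing_inv _ (Ne.isUnit hdet),
      Matrix.one_mulVec]
  have hMη' : ∀ i, ∑ j, A (b i) (b j) * η j = ξ i := by
    intro i
    have h := congrFun hMη i
    simp only [Matrix.mulVec, dotProduct, Matrix.of_apply] at h
    exact h
  have hη0 : η ≠ 0 := by
    intro h0
    apply hξ
    rw [← hMη, h0, Matrix.mulVec_zero]
  set v : E := ∑ i, η i • b i with hv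
  have hv0 : v ≠ 0 := by
    intro h0
    apply hη0
    funext i
    exact Fintype.linearIndependent_iff.1 b.linearIndependent η h0 i
  have hexp : A v v = ∑ i, η i * ∑ j, η j * A (b j) (b i) := by
    rw [hv]
    simp only [map_sum, map_smul, FunLike.coe_sum, Finset.sum_apply, FunLike.coe_smul,
      Pi.smul_apply, smul_eq_mul]
  have hAvv : A v v = ∑ j, η j * ξ j := by
    rw [hexp]
    simp only [Finset.mul_sum]
    rw [Finset.sum_comm]
    refine Finset.sum_congr rfl fun j _ ↦ ?_
    rw [← hMη' j, Finset.mul_sum]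
    exact Finset.sum_congr rfl fun i _ ↦ by ring
  have hsum : ∑ p, ∑ q, gramInv b A q p * ξ p * ξ q = ∑ q, η q * ξ q := by
    rw [Finset.sum_comm]
    refine Finset.sum_congr rfl fun q _ ↦ ?_
    have hq : η q = ∑ p, gramInv b A q p * ξ p := by
      simp only [hη, Matrix.mulVec, dotProduct]
    rw [hq, Finset.sum_mul]
  rw [hsum, ← hAvv]
  exact hpos v hv0

omit [DecidableEq ι] in
/-- **Uniform ellipticity of a continuous family of positive definite quadratic forms on a
compact set**: if `ξ ↦ ∑ Gi(x)_{qp} ξ_p ξ_q` is positive definite for every `x ∈ K`, `K`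
compact, and the coefficients are continuous on `K`, then there is `λ > 0` with
`λ ∑ ξ_p² ≤ ∑ Gi(x)_{qp} ξ_p ξ_q` for all `x ∈ K` and all `ξ` (minimise over `K × {‖ξ‖ = 1}`,
then use homogeneity and `∑ ξ_p² ≤ |ι| ‖ξ‖²_∞`). [folklore] -/
theorem exists_ellipticity_const {K : Set X} (hK : IsCompact K) {Gi : X → ι → ι → ℝ}
    (hGi : ∀ p q, ContinuousOn (fun x ↦ Gi x q p) K)
    (hpos : ∀ x ∈ K, ∀ ξ : ι → ℝ, ξ ≠ 0 → 0 < ∑ p, ∑ q, Gi x q p * ξ p * ξ q) :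
    ∃ lam : ℝ, 0 < lam ∧ ∀ x ∈ K, ∀ ξ : ι → ℝ,
      lam * ∑ p, ξ p ^ 2 ≤ ∑ p, ∑ q, Gi x q p * ξ p * ξ q := by
  set f : X × (ι → ℝ) → ℝ := fun z ↦ ∑ p, ∑ q, Gi z.1 q p * z.2 p * z.2 q with hf
  set Ks : Set (X × (ι → ℝ)) := K ×ˢ Metric.sphere 0 1 with hKs
  have hKsc : IsCompact Ks := hK.prod (isCompact_sphere 0 1)
  have hfc : ContinuousOn f Ks := by
    have h1 : ∀ p q, ContinuousOn (fun z : X × (ι → ℝ) ↦ Gi z.1 q p) Ks :=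
      fun p q ↦ (hGi p q).comp continuous_fst.continuousOn fun z hz ↦ hz.1
    have h2 : ∀ p, ContinuousOn (fun z : X × (ι → ℝ) ↦ z.2 p) Ks :=
      fun p ↦ ((continuous_apply p).comp continuous_snd).continuousOn
    simp only [hf]
    refine continuousOn_finsetSum _ fun p _ ↦ continuousOn_finsetSum _ fun q _ ↦ ?_
    exact ((h1 p q).mul (h2 p)).mul (h2 q)
  have hfpos : ∀ z ∈ Ks, 0 < f z := by
    rintro ⟨x, ξ⟩ ⟨hx, hξ⟩
    have hξ0 : ξ ≠ 0 := by
      intro h0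
      rw [h0, mem_sphere_zero_iff_norm, norm_zero] at hξ
      exact zero_ne_one hξ
    exact hpos x hx ξ hξ0
  -- homogeneity and comparison of `∑ ξ²` with the sup norm
  have hhom : ∀ (x : X) (r : ℝ) (ξ : ι → ℝ), f (x, r • ξ) = r ^ 2 * f (x, ξ) := by
    intro x r ξ
    simp only [hf, Pi.smul_apply, smul_eq_mul, Finset.mul_sum]
    refine Finset.sum_congr rfl fun p _ ↦ Finset.sum_congr rfl fun q _ ↦ ?_
    ring
  have hsq : ∀ ξ : ι → ℝ, ∑ p, ξ p ^ 2 ≤ Fintype.card ι * ‖ξ‖ ^ 2 := by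
    intro ξ
    have h1 : ∀ p, ξ p ^ 2 ≤ ‖ξ‖ ^ 2 := fun p ↦ by
      rw [← sq_abs, ← Real.norm_eq_abs]
      exact pow_le_pow_left₀ (norm_nonneg _) (norm_le_pi_norm ξ p) 2
    calc ∑ p, ξ p ^ 2 ≤ ∑ _p : ι, ‖ξ‖ ^ 2 := Finset.sum_le_sum fun p _ ↦ h1 p
      _ = Fintype.card ι * ‖ξ‖ ^ 2 := by
          rw [Finset.sum_const, Finset.card_univ, nsmul_eq_mul]
  have hzero : ∀ x : X, f (x, 0) = 0 := by
    intro x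
    simp only [hf, Pi.zero_apply, mul_zero, Finset.sum_const_zero]
  -- the minimum over `Ks`
  have key : ∃ lam₀ : ℝ, 0 < lam₀ ∧ ∀ x ∈ K, ∀ ξ : ι → ℝ, lam₀ * ‖ξ‖ ^ 2 ≤ f (x, ξ) := by
    by_cases hne : Ks.Nonempty
    · obtain ⟨z₀, hz₀, hmin⟩ := hKsc.exists_isMinOn hne hfc
      refine ⟨f z₀, hfpos z₀ hz₀, fun x hx ξ ↦ ?_⟩
      by_cases hξ : ξ = 0
      · subst hξ
        rw [norm_zero, zero_pow two_ne_zero, mul_zero, hzero]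
      · have hξn : 0 < ‖ξ‖ := norm_pos_iff.2 hξ
        have hmem : (x, ‖ξ‖⁻¹ • ξ) ∈ Ks := by
          refine ⟨hx, ?_⟩
          rw [mem_sphere_zero_iff_norm, norm_smul, norm_inv, norm_norm, inv_mul_cancel₀ hξn.ne']
        have h1 : f z₀ ≤ f (x, ‖ξ‖⁻¹ • ξ) := hmin hmem
        rw [hhom] at h1
        have h3 : f z₀ * ‖ξ‖ ^ 2 ≤ ‖ξ‖⁻¹ ^ 2 * f (x, ξ) * ‖ξ‖ ^ 2 :=
          mul_le_mul_of_nonneg_right h1 (by positivity)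
        calc f z₀ * ‖ξ‖ ^ 2 ≤ ‖ξ‖⁻¹ ^ 2 * f (x, ξ) * ‖ξ‖ ^ 2 := h3
          _ = f (x, ξ) := by field_simp
    · refine ⟨1, one_pos, fun x hx ξ ↦ ?_⟩
      by_cases hξ : ξ = 0
      · subst hξ
        rw [norm_zero, zero_pow two_ne_zero, mul_zero, hzero]
      · exfalso
        apply hne
        have hξn : 0 < ‖ξ‖ := norm_pos_iff.2 hξ
        refine ⟨(x, ‖ξ‖⁻¹ • ξ), hx, ?_⟩
        rw [mem_sphere_zero_iff_norm, norm_smul, norm_inv, norm_norm, inv_mul_cancel₀ hξn.ne']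
  obtain ⟨lam₀, hlam₀, hkey⟩ := key
  refine ⟨lam₀ / max 1 (Fintype.card ι : ℝ), by positivity, fun x hx ξ ↦ ?_⟩
  have hm : (Fintype.card ι : ℝ) ≤ max 1 (Fintype.card ι : ℝ) := le_max_right _ _
  have hm0 : 0 < max 1 (Fintype.card ι : ℝ) := by positivity
  have h1 := hkey x hx ξ
  have h2 := hsq ξ
  calc lam₀ / max 1 (Fintype.card ι : ℝ) * ∑ p, ξ p ^ 2
      ≤ lam₀ / max 1 (Fintype.card ι : ℝ) * (max 1 (Fintype.card ι : ℝ) * ‖ξ‖ ^ 2) := by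
        refine mul_le_mul_of_nonneg_left (h2.trans ?_) (by positivity)
        exact mul_le_mul_of_nonneg_right hm (by positivity)
    _ = lam₀ * ‖ξ‖ ^ 2 := by field_simp
    _ ≤ f (x, ξ) := h1

end Generic

/-! ### The data of the difference of two flows read in a chart -/

section ChartData

variable {E : Type*} [NormedAddCommGroup E] [NormedSpace ℝ E] {H : Type*} [TopologicalSpace H]
  {I : ModelWithCorners ℝ E H} [I.Boundaryless] {M : Type*} [TopologicalSpace M]
  [ChartedSpace H M] [IsManifold I ∞ M] [FiniteDimensional ℝ E]
  {ι : Type*} [Fintype ι] [DecidableEq ι]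

variable (I) in
/-- **The background Christoffel field read in the chart at `z`**:
`Γ̃(y)(Y₁, X₁) = chris b (Hr⁻¹(y)) (DHr(y)) Y₁ X₁` for the representative
`Hr = chartRep I (fun _ ↦ h) z 0` of the background metric `h`
(`leviCivita_chartPullback_const_apply`). [cite: ONeill1983, Ch. 3, Prop. 3.13] -/
def bgChris (b : Module.Basis ι ℝ E) (h : PseudoRiemannianMetric I ∞ E (TangentSpace I : M → Type _))
    (z : M) (y Y₁ X₁ : E) : E :=
  chris b (gramInv b (chartRep I (fun _ ↦ h) z 0 y)) (fderiv ℝ (chartRep I (fun _ ↦ h) z 0) y) Y₁ X₁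

variable (I) in
/-- **The lower-order part of the coordinate Ricci–DeTurck operator** for the family `k` read
in the chart at `z`, at time `t`, point `y` and vectors `X₀, Y₀`:
`rdtLower b (G_t y) g⁻¹ (DG_t y) Γ̃ DΓ̃ (X₀, Y₀)`, the first-order data of the representative
`G_t = chartRep I k z t` inserted in the explicit expression `rdtLower` of
`RicciDeTurckCoord.lean` (Andrews–Hopper 2011, §5.4.1, (5.6)–(5.9)).
[cite: AndrewsHopper2011, §5.4.1, (5.6)–(5.9)] -/
def chartLower (b : Module.Basis ι ℝ E) (k : ℝ → PseudoRiemannianMetric I ∞ E (TangentSpace I : M → Type _))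
    (h : PseudoRiemannianMetric I ∞ E (TangentSpace I : M → Type _)) (z : M) (t : ℝ)
    (y X₀ Y₀ : E) : ℝ :=
  rdtLower b (chartRep I k z t y) (gramInv b (chartRep I k z t y))
    (fderiv ℝ (chartRep I k z t) y) (bgChris I b h z y)
    (fun V Y₁ X₁ ↦ fderiv ℝ (fun y' : E ↦ bgChris I b h z y' Y₁ X₁) y V) X₀ Y₀

variable (I) in
/-- **The right-hand side of the coordinate Ricci–DeTurck equation** for the family `k` read in
the chart at `z`, at time `t`, point `y` and vectors `X₀, Y₀`:
`gʲⁱ D²G_t(y)(bᵢ, bⱼ)(X₀, Y₀) + rdtLower b (G_t y) g⁻¹ (DG_t y) Γ̃ DΓ̃ (X₀, Y₀)` (the derivative in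
`IsRicciDeTurckFlow.hasDerivWithinAt_chartRep`; Andrews–Hopper 2011, (5.10) in coordinates).
[cite: AndrewsHopper2011, §5.4.2, (5.10)] -/
def chartRHS (b : Module.Basis ι ℝ E) (k : ℝ → PseudoRiemannianMetric I ∞ E (TangentSpace I : M → Type _))
    (h : PseudoRiemannianMetric I ∞ E (TangentSpace I : M → Type _)) (z : M) (t : ℝ)
    (y X₀ Y₀ : E) : ℝ :=
  (∑ i, ∑ j, gramInv b (chartRep I k z t y) j i *
      fderiv ℝ (fderiv ℝ (chartRep I k z t)) y (b i) (b j) X₀ Y₀)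
    + chartLower I b k h z t y X₀ Y₀

variable (I) in
/-- **The square norm of the difference of two families read in the chart at `z`**:
`û_t(y) = ⟨G¹_t(y) - G²_t(y), G¹_t(y) - G²_t(y)⟩_{h(y)} = normSqCoord b (Hr⁻¹(y)) H H`,
`H = chartRep I k₁ z t y - chartRep I k₂ z t y`; on the chart target this is
`|k₁(t) - k₂(t)|²_h` at `Φ y` (`normSq_sub_eq_chartNormSq`). [cite: AndrewsHopper2011, §5.4.2, Step 1] -/
def chartNormSq (b : Module.Basis ι ℝ E) (h : PseudoRiemannianMetric I ∞ E (TangentSpace I : M → Type _))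
    (k₁ k₂ : ℝ → PseudoRiemannianMetric I ∞ E (TangentSpace I : M → Type _)) (z : M) (t : ℝ)
    (y : E) : ℝ :=
  normSqCoord b (gramInv b (chartRep I (fun _ ↦ h) z 0 y))
    (chartRep I k₁ z t y - chartRep I k₂ z t y) (chartRep I k₁ z t y - chartRep I k₂ z t y)

variable (I) in
/-- The time derivative `∂ₜ(G¹ - G²)` of the difference of two Ricci–DeTurck flows read in the
chart, as the bilinear form with components `chartRHS k₁ - chartRHS k₂` on basis pairs
(`bilinOfCoeffs`). [cite: AndrewsHopper2011, §5.4.2, (5.10)] -/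
def chartDot (b : Module.Basis ι ℝ E) (h : PseudoRiemannianMetric I ∞ E (TangentSpace I : M → Type _))
    (k₁ k₂ : ℝ → PseudoRiemannianMetric I ∞ E (TangentSpace I : M → Type _)) (z : M) (t : ℝ)
    (y : E) : E →L[ℝ] E →L[ℝ] ℝ :=
  bilinOfCoeffs b fun c i ↦ chartRHS I b k₁ h z t y (b c) (b i) - chartRHS I b k₂ h z t y (b c) (b i)

/-- The coordinate Ricci–DeTurck equation with the right-hand side `chartRHS`
(`IsRicciDeTurckFlow.hasDerivWithinAt_chartRep`). [cite: AndrewsHopper2011, §5.4.2, (5.10)] -/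
theorem IsRicciDeTurckFlow.hasDerivWithinAt_chartRep_chartRHS [CompleteSpace E]
    (b : Module.Basis ι ℝ E) {k : ℝ → PseudoRiemannianMetric I ∞ E (TangentSpace I : M → Type _)}
    {cov : ℝ → CovariantDerivative I E (TangentSpace I : M → Type _)}
    {bg : CovariantDerivative I E (TangentSpace I : M → Type _)} {S : Set ℝ}
    (hk : IsRicciDeTurckFlow k cov bg S)
    {h : PseudoRiemannianMetric I ∞ E (TangentSpace I : M → Type _)} (hbg : h.IsLeviCivita bg)
    (z : M) {t : ℝ} (ht : t ∈ S) (y : chartTarget I z) (X₀ Y₀ : E) :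
    HasDerivWithinAt (fun s : ℝ ↦ chartRep I k z s y X₀ Y₀) (chartRHS I b k h z t y X₀ Y₀) S t :=
  hk.hasDerivWithinAt_chartRep b hbg z ht y X₀ Y₀

/-- The inverse Gram matrix of the background representative is symmetric on the chart target.
[folklore] -/
theorem gramInv_chartRep_const_symm (b : Module.Basis ι ℝ E)
    (h : PseudoRiemannianMetric I ∞ E (TangentSpace I : M → Type _)) (z : M)
    (y : chartTarget I z) (i j : ι) :
    gramInv b (chartRep I (fun _ ↦ h) z 0 y) i j = gramInv b (chartRep I (fun _ ↦ h) z 0 y) j i := by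
  refine gramInv_symm b (fun v w ↦ ?_) i j
  rw [← val_chartPullback_eq_chartRep (fun _ ↦ h) z 0 y]
  exact (chartPullback I h z).symm y v w

/-- The inverse Gram matrix of a family read in the chart is symmetric on the chart target.
[folklore] -/
theorem gramInv_chartRep_symm (b : Module.Basis ι ℝ E)
    (k : ℝ → PseudoRiemannianMetric I ∞ E (TangentSpace I : M → Type _)) (z : M) (t : ℝ)
    (y : chartTarget I z) (i j : ι) :
    gramInv b (chartRep I k z t y) i j = gramInv b (chartRep I k z t y) j i := by
  refine gramInv_symm b (fun v w ↦ ?_) i j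
  rw [← val_chartPullback_eq_chartRep k z t y]
  exact (chartPullback I (k t) z).symm y v w

/-- **Time derivative of the square norm of the difference of two Ricci–DeTurck flows, in the
chart**: `d/ds û_s(y) = 2 ⟨∂ₜ(G¹ - G²), G¹_t - G²_t⟩_{h(y)}` within `S` at `t`, with
`∂ₜ(G¹ - G²) = chartDot` (`hasDerivWithinAt_normSqCoord` and the coordinate Ricci–DeTurck
equation for both flows). [cite: AndrewsHopper2011, §5.4.2, Step 1] -/
theorem hasDerivWithinAt_chartNormSq [CompleteSpace E] (b : Module.Basis ι ℝ E)
    {k₁ k₂ : ℝ → PseudoRiemannianMetric I ∞ E (TangentSpace I : M → Type _)}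
    {c₁ c₂ : ℝ → CovariantDerivative I E (TangentSpace I : M → Type _)}
    {bg : CovariantDerivative I E (TangentSpace I : M → Type _)} {S : Set ℝ}
    (hk₁ : IsRicciDeTurckFlow k₁ c₁ bg S) (hk₂ : IsRicciDeTurckFlow k₂ c₂ bg S)
    {h : PseudoRiemannianMetric I ∞ E (TangentSpace I : M → Type _)} (hbg : h.IsLeviCivita bg)
    (z : M) {t : ℝ} (ht : t ∈ S) (y : chartTarget I z) :
    HasDerivWithinAt (fun s : ℝ ↦ chartNormSq I b h k₁ k₂ z s y)
      (2 * normSqCoord b (gramInv b (chartRep I (fun _ ↦ h) z 0 y)) (chartDot I b h k₁ k₂ z t y)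
        (chartRep I k₁ z t y - chartRep I k₂ z t y)) S t := by
  unfold chartNormSq
  refine hasDerivWithinAt_normSqCoord b (gramInv_chartRep_const_symm b h z y)
    (T := fun s ↦ chartRep I k₁ z s y - chartRep I k₂ z s y) (T' := chartDot I b h k₁ k₂ z t y)
    fun i j ↦ ?_
  simp only [_root_.sub_apply]
  rw [chartDot, bilinOfCoeffs_basis]
  exact (hk₁.hasDerivWithinAt_chartRep_chartRHS b hbg z ht y (b i) (b j)).sub
    (hk₂.hasDerivWithinAt_chartRep_chartRHS b hbg z ht y (b i) (b j))

/-- **The square norm of the difference read in the chart**: for `y` in the chart target at `z`,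
`|k₁(t) - k₂(t)|²_h (Φ y) = û_t(y)` (naturality of the metric square norm under the local
diffeomorphism `Φ = chartInv I z`, `normSq_chartPullback_eq`, and the coordinate formula
`normSq_eq_normSqCoord`). [cite: ONeill1983, Ch. 3, Prop. 3.59] -/
theorem normSq_sub_eq_chartNormSq (b : Module.Basis ι ℝ E)
    (h : PseudoRiemannianMetric I ∞ E (TangentSpace I : M → Type _))
    (k₁ k₂ : ℝ → PseudoRiemannianMetric I ∞ E (TangentSpace I : M → Type _)) (z : M) (t : ℝ)
    (y : chartTarget I z) :
    h.normSq (chartInv I z y)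
        ((k₁ t).toBilinForm (chartInv I z y) - (k₂ t).toBilinForm (chartInv I z y)) =
      chartNormSq I b h k₁ k₂ z t y := by
  have hH : ∀ y : chartTarget I z, (chartPullback I h z).val y = chartRep I (fun _ ↦ h) z 0 y :=
    val_chartPullback_eq_chartRep (fun _ ↦ h) z 0
  rw [chartNormSq, ← normSq_eq_normSqCoord hH b y
    (bilinT y (chartRep I k₁ z t y - chartRep I k₂ z t y)) _ (fun v w ↦ rfl)]
  refine (normSq_chartPullback_eq h z y _ _ fun v w ↦ ?_).symm
  rw [bilinT_apply, _root_.sub_apply, _root_.sub_apply, LinearMap.sub_apply, LinearMap.sub_apply,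
    PseudoRiemannianMetric.toBilinForm_apply, PseudoRiemannianMetric.toBilinForm_apply,
    chartRep_apply, chartRep_apply]
  rfl

/-- `û ≥ 0` on the chart target for a Riemannian background. [folklore] -/
theorem chartNormSq_nonneg (b : Module.Basis ι ℝ E)
    {h : PseudoRiemannianMetric I ∞ E (TangentSpace I : M → Type _)} (hh : h.IsRiemannian)
    (k₁ k₂ : ℝ → PseudoRiemannianMetric I ∞ E (TangentSpace I : M → Type _)) (z : M) (t : ℝ)
    (y : chartTarget I z) : 0 ≤ chartNormSq I b h k₁ k₂ z t y := by
  rw [← normSq_sub_eq_chartNormSq b h k₁ k₂ z t y]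
  exact h.normSq_nonneg _ hh _

/-- **Joint continuity of `û` on `target × S`** for families `C^∞` on `M × S`. [folklore] -/
theorem continuousOn_chartNormSq (b : Module.Basis ι ℝ E)
    {k₁ k₂ : ℝ → PseudoRiemannianMetric I ∞ E (TangentSpace I : M → Type _)} {S : Set ℝ}
    (hk₁ : IsContMDiffFamilyOn ∞ k₁ S) (hk₂ : IsContMDiffFamilyOn ∞ k₂ S)
    (h : PseudoRiemannianMetric I ∞ E (TangentSpace I : M → Type _)) (z : M) :
    ContinuousOn (fun q : E × ℝ ↦ chartNormSq I b h k₁ k₂ z q.2 q.1)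
      ((extChartAt I z).target ×ˢ S) := by
  have hH : ∀ y : chartTarget I z, (chartPullback I h z).val y = chartRep I (fun _ ↦ h) z 0 y :=
    val_chartPullback_eq_chartRep (fun _ ↦ h) z 0
  have hD : ContinuousOn (fun q : E × ℝ ↦ chartRep I k₁ z q.2 q.1 - chartRep I k₂ z q.2 q.1)
      ((extChartAt I z).target ×ˢ S) :=
    (contDiffOn_chartRep hk₁ z).continuousOn.sub (contDiffOn_chartRep hk₂ z).continuousOn
  have hGi : ∀ j i, ContinuousOn
      (fun q : E × ℝ ↦ gramInv b (chartRep I (fun _ ↦ h) z 0 q.1) j i)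
      ((extChartAt I z).target ×ˢ S) := fun j i q hq ↦
    (ContinuousAt.comp (f := Prod.fst) (x := q)
      (continuousAt_gramInv_repr hH b ⟨q.1, hq.1⟩ j i) continuousAt_fst).continuousWithinAt
  have hev : ∀ v w, ContinuousOn
      (fun q : E × ℝ ↦ (chartRep I k₁ z q.2 q.1 - chartRep I k₂ z q.2 q.1) v w)
      ((extChartAt I z).target ×ˢ S) := fun v w ↦
    (hD.clm_apply continuousOn_const).clm_apply continuousOn_const
  simp only [chartNormSq, normSqCoord]
  refine continuousOn_finsetSum _ fun i _ ↦ continuousOn_finsetSum _ fun j _ ↦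
    continuousOn_finsetSum _ fun a _ ↦ continuousOn_finsetSum _ fun c _ ↦ ?_
  exact (((hGi j i).mul (hGi c a)).mul (hev (b c) (b i))).mul (hev (b a) (b j))

/-! ### Regularity of the data on the chart target -/

/-- Each time slice of the representative of a family `C^∞` on `M × S` is `C^∞` on the chart
target. [folklore] -/
theorem contDiffOn_chartRep_slice {k : ℝ → PseudoRiemannianMetric I ∞ E (TangentSpace I : M → Type _)}
    {S : Set ℝ} (hk : IsContMDiffFamilyOn ∞ k S) (z : M) {t : ℝ} (ht : t ∈ S) :
    ContDiffOn ℝ ∞ (chartRep I k z t) (extChartAt I z).target := fun y hy ↦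
  (ContDiffOn.contDiffAt_slice (isOpen_extChartAt_target z) (contDiffOn_chartRep hk z)
    (q := (y, t)) ⟨hy, ht⟩).contDiffWithinAt

/-- The first derivative of a time slice is `C^∞` on the chart target. [folklore] -/
theorem contDiffOn_fderiv_chartRep_slice
    {k : ℝ → PseudoRiemannianMetric I ∞ E (TangentSpace I : M → Type _)}
    {S : Set ℝ} (hk : IsContMDiffFamilyOn ∞ k S) (z : M) {t : ℝ} (ht : t ∈ S) :
    ContDiffOn ℝ ∞ (fderiv ℝ (chartRep I k z t)) (extChartAt I z).target :=
  (contDiffOn_chartRep_slice hk z ht).fderiv_of_isOpen (isOpen_extChartAt_target z) (le_of_eq rfl)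

/-- The second derivative of a time slice is `C^∞` on the chart target. [folklore] -/
theorem contDiffOn_fderiv_fderiv_chartRep_slice
    {k : ℝ → PseudoRiemannianMetric I ∞ E (TangentSpace I : M → Type _)}
    {S : Set ℝ} (hk : IsContMDiffFamilyOn ∞ k S) (z : M) {t : ℝ} (ht : t ∈ S) :
    ContDiffOn ℝ ∞ (fderiv ℝ (fderiv ℝ (chartRep I k z t))) (extChartAt I z).target :=
  (contDiffOn_fderiv_chartRep_slice hk z ht).fderiv_of_isOpen (isOpen_extChartAt_target z)
    (le_of_eq rfl)

/-- **The inverse Gram entries of the background representative are `C^∞` on the chart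
target** (`contMDiffAt_matrix_inv`). [folklore] -/
theorem contDiffOn_gramInv_chartRep_const (b : Module.Basis ι ℝ E)
    (h : PseudoRiemannianMetric I ∞ E (TangentSpace I : M → Type _)) (z : M) (j i : ι) :
    ContDiffOn ℝ ∞ (fun y ↦ gramInv b (chartRep I (fun _ ↦ h) z 0 y) j i)
      (extChartAt I z).target := by
  intro y hy
  have hH : ∀ y : chartTarget I z, (chartPullback I h z).val y = chartRep I (fun _ ↦ h) z 0 y :=
    val_chartPullback_eq_chartRep (fun _ ↦ h) z 0
  have hA : ∀ i' j', ContDiffAt ℝ ∞ (fun y' ↦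
      (Matrix.of fun i' j' ↦ chartRep I (fun _ ↦ h) z 0 y' (b i') (b j')) i' j') y := fun i' j' ↦
    ((contDiffAt_chartRep_const h z ⟨y, hy⟩).clm_apply contDiffAt_const).clm_apply contDiffAt_const
  have h1 := contMDiffAt_matrix_inv (I := 𝓘(ℝ, E)) (k := ∞)
    (A := fun y' ↦ Matrix.of fun i' j' ↦ chartRep I (fun _ ↦ h) z 0 y' (b i') (b j')) (x₀ := y)
    (fun i' j' ↦ contMDiffAt_iff_contDiffAt.2 (hA i' j')) (det_gram_repr_ne_zero hH b ⟨y, hy⟩) j i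
  exact (contMDiffAt_iff_contDiffAt.1 h1).contDiffWithinAt

/-- **The inverse Gram entries of a family read in the chart are continuous on `target × S`.**
[folklore] -/
theorem continuousOn_gramInv_chartRep (b : Module.Basis ι ℝ E)
    {k : ℝ → PseudoRiemannianMetric I ∞ E (TangentSpace I : M → Type _)} {S : Set ℝ}
    (hk : IsContMDiffFamilyOn ∞ k S) (z : M) (j i : ι) :
    ContinuousOn (fun q : E × ℝ ↦ gramInv b (chartRep I k z q.2 q.1) j i)
      ((extChartAt I z).target ×ˢ S) := by
  intro q hq
  have hc : ∀ i' j', ContinuousWithinAt (fun q' : E × ℝ ↦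
      (Matrix.of fun i' j' ↦ chartRep I k z q'.2 q'.1 (b i') (b j')) i' j')
      ((extChartAt I z).target ×ˢ S) q := fun i' j' ↦ by
    simp only [Matrix.of_apply]
    exact (((contDiffOn_chartRep hk z).continuousOn q hq).clm_apply
      continuousWithinAt_const).clm_apply continuousWithinAt_const
  have hdet : (Matrix.of fun i' j' ↦ chartRep I k z q.2 q.1 (b i') (b j')).det ≠ 0 :=
    det_gram_repr_ne_zero (val_chartPullback_eq_chartRep k z q.2) b ⟨q.1, hq.1⟩
  exact continuousWithinAt_matrix_inv_apply hc hdet j i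

/-- **The background Christoffel representative is `C^∞` on the chart target** (its data are the
`C^∞` inverse Gram entries and first derivatives of `Hr`). [folklore] -/
theorem contDiffOn_bgChris (b : Module.Basis ι ℝ E)
    (h : PseudoRiemannianMetric I ∞ E (TangentSpace I : M → Type _)) (z : M) (Y₁ X₁ : E) :
    ContDiffOn ℝ ∞ (fun y ↦ bgChris I b h z y Y₁ X₁) (extChartAt I z).target := by
  have hHr : ContDiffOn ℝ ∞ (chartRep I (fun _ ↦ h) z 0) (extChartAt I z).target :=
    contDiffOn_chartRep_const h z
  have hD : ContDiffOn ℝ ∞ (fun y ↦ fderiv ℝ (chartRep I (fun _ ↦ h) z 0) y)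
      (extChartAt I z).target :=
    hHr.fderiv_of_isOpen (isOpen_extChartAt_target z) (le_of_eq rfl)
  have hDa : ∀ u v w : E, ContDiffOn ℝ ∞ (fun y ↦ fderiv ℝ (chartRep I (fun _ ↦ h) z 0) y u v w)
      (extChartAt I z).target := fun u v w ↦
    ((hD.clm_apply contDiffOn_const).clm_apply contDiffOn_const).clm_apply contDiffOn_const
  have hGi := contDiffOn_gramInv_chartRep_const b h z
  unfold bgChris chris kos
  refine ContDiffOn.sum fun a _ ↦ ?_
  refine (ContDiffOn.sum fun c _ ↦ ?_).smul contDiffOn_const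
  exact (hGi c a).mul (contDiffOn_const.mul (((hDa _ _ _).add (hDa _ _ _)).sub (hDa _ _ _)))

/-- The derivatives of the background Christoffel components are continuous on the chart target.
[folklore] -/
theorem continuousOn_fderiv_bgChris (b : Module.Basis ι ℝ E)
    (h : PseudoRiemannianMetric I ∞ E (TangentSpace I : M → Type _)) (z : M) (Y₁ X₁ : E) :
    ContinuousOn (fun y ↦ fderiv ℝ (fun y' ↦ bgChris I b h z y' Y₁ X₁) y)
      (extChartAt I z).target :=
  (contDiffOn_bgChris b h z Y₁ X₁).continuousOn_fderiv_of_isOpen (isOpen_extChartAt_target z)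
    (by exact_mod_cast le_top)

/-! ### The sign of the elliptic part at a spatial maximum, and ellipticity -/

/-- **At a local maximum `y₀` of a `C²` function `F` on the chart target, `g₁ᵖ𐞥 ∂ₚ∂_q F(y₀) ≤ 0`**
for the inverse metric of a Riemannian `k t` read in the chart: the contraction is the metric
trace `tr_{g₁} D²F(y₀)` (`trace_eq_sum_gram_inv`), the Hessian is negative semidefinite at a
local maximum (`IsLocalMax.fderiv_fderiv_apply_self_nonpos`, `MorseExtrema.lean`), and the
metric trace of a nonpositive form is nonpositive (`trace_nonpos_of_forall_apply_self_nonpos`).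
This is the step "`Δu ≤ 0` at a maximum" of Topping 2006, proof of Thm. 3.1.1.
[cite: Topping2006, Thm. 3.1.1 (proof, p. 35)] -/
theorem sum_gramInv_fderiv_fderiv_nonpos (b : Module.Basis ι ℝ E)
    {k : ℝ → PseudoRiemannianMetric I ∞ E (TangentSpace I : M → Type _)} {t : ℝ}
    (hpos : (k t).IsRiemannian) (z : M) (y₀ : chartTarget I z) {F : E → ℝ}
    (hF : ContDiffAt ℝ 2 F y₀) (hmax : IsLocalMax F y₀) :
    ∑ p, ∑ q, gramInv b (chartRep I k z t y₀) q p * fderiv ℝ (fderiv ℝ F) y₀ (b p) (b q) ≤ 0 := by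
  set g' := chartPullback I (k t) z
  have hG : ∀ y : chartTarget I z, g'.val y = chartRep I k z t y := val_chartPullback_eq_chartRep k z t
  have hpos' : ∀ v : TangentSpace 𝓘(ℝ, E) y₀, v ≠ 0 → 0 < g'.val y₀ v v :=
    chartPullback_pos (k t) z y₀ (fun v hv ↦ hpos _ v hv)
  have htr : g'.trace y₀ (bilinT y₀ (fderiv ℝ (fderiv ℝ F) y₀)) ≤ 0 :=
    trace_nonpos_of_forall_apply_self_nonpos g' hpos' _ fun v ↦
      Literature.Topology.FourManifolds.IsLocalMax.fderiv_fderiv_apply_self_nonpos hF hmax v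
  rw [trace_eq_sum_gram_inv g' y₀ (basisT b y₀), gram_inv_eq_gramInv hG b y₀] at htr
  exact htr

/-- **The inverse metric read in the chart is positive definite**: for a Riemannian `k t` and
`y` in the chart target, `∑ g₁(y)^{qp} ξ_p ξ_q > 0` for `ξ ≠ 0` (`gramInv_quadratic_pos`).
[folklore] -/
theorem gramInv_chartRep_quadratic_pos (b : Module.Basis ι ℝ E)
    {k : ℝ → PseudoRiemannianMetric I ∞ E (TangentSpace I : M → Type _)} {t : ℝ}
    (hpos : (k t).IsRiemannian) (z : M) (y : chartTarget I z) {ξ : ι → ℝ} (hξ : ξ ≠ 0) :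
    0 < ∑ p, ∑ q, gramInv b (chartRep I k z t y) q p * ξ p * ξ q := by
  have hG : ∀ y : chartTarget I z, (chartPullback I (k t) z).val y = chartRep I k z t y :=
    val_chartPullback_eq_chartRep k z t
  refine gramInv_quadratic_pos b (fun v hv ↦ ?_) (det_gram_repr_ne_zero hG b y) hξ
  rw [← hG y]
  exact chartPullback_pos (k t) z y (fun w hw ↦ hpos _ w hw) v hv

end ChartData

end Literature.Geometry.Riemannian

end
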